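import Summits.QuantumFields.YangMills.Theorems.UnitScaleTiltFluctuationComparisonRegPrGlobalSlackKernelLegDisplayProfileLowV4
import HarnessLib

/-!
# `UnitScaleTiltFluctuationComparisonRegPrGlobalSlackKernelLegDisplayTwoRunProfileV4` — 3⁗χ'S SIX-ROW DISPLAY AT A PROFILE `p₁` IN TWO-RUN CURRENCY (no reference objects), THE
# «NOTHING LOST» MAPS FROM THE PER-RUN DISPLAYS OF RECORD, KING'S SLACK ROW AND THE DECIDING CRUX RE-THREADED THROUGH IT (crux `FluctuationComparisonRegPrIntL`, stmt-QuantumFields-20520,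
# skeleton v5kD, STUB 3⁗χ(v4) `stub_globalTwoRunSlackFamChiV4`; width seat ym-ust-20520-w2 g5 on ★★OWNER ACK 50 (4) «GO-(B) LISTED»; count-neutral helper, registry untouched; the displays of
# record ✓`K1aLegRowsDisplayChiAtV4` / ✓`K1aLegRowsDisplayChiAtLowV4` and their doors stay byte-untouched — this file is ADDITIVE)

WHY.  The per-run displays of record `K1aLegRowsDisplayChiAtV4` (★w1 lineage, v4 twin ★w2 g4) state (R1) as the ALL-INDEX own-indexed kernel row `KernelRefOwnΦ … Φ Ψ …` against a
height-free reference chart family `Ψ` and (R5) as `CfgRefOwnΦ … B BR …` against a coherent reference configuration functional `BR`, both reference objects quantified BEFORE the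
(α) hypothesis.  Their one consumer, ✓`globalSupRateTSlack_of_k1aLegRowsDisplayChiAtV4`, converts these rows ONE LINE IN back to the two-run currency of the interface —
`hK2 := flatKernelLegCauchyΦ_of_ref hΨ (kernelRefΦ_canonRows_of_own …)`, `hS2 := cfgDistΦ_of_own …`, `hBC2 := cfgDistCauchyΦ_of_ref hBR (cfgRefΦ_of_own …)` — and only then
feeds lane A's `globalTwoRunSlackTail_of_chartsC`.  So a supplier holding the TWO-RUN rows for ONE family (the natural objects of ym-inputs-p11's door ✓`k1aLegRowsDisplayChiAtLowV4_of_kernelRows`)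
would have to CONSTRUCT `Ψ`/`BR` (ym-inputs-p10 g2's `exists_kernelRefOwnΦ_of_twoRun` / `exists_refCfgCoherent_of_twoRun`) only for the consumer to discard them again — and the
all-index strength of `KernelRefOwnΦ` asks the constructor for letters (`hsym`, `hT`) at indices no printed row speaks to (LOCATED 2026-08-28, this seat; OWNER ACK 50 (4)).
THIS FILE records the display DIRECTLY in the consumer's currency (precedent: ✓`K1aLegRowsRChiV4`, two-run currency at the record's profile `p₀`):

* §1 **`K1aLegRowsDisplayTwoRunChiAtV4 L 𝔠 a₀ a₁ a p₁`** (hypothesis schema, never asserted): constants `κ′ ρ C C_A C_s C_B γB`; for every family / coupling / inhabited χ-package a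
  coherent `p` and ONE `(Φ, e, B)` with (K) K1a `FlatKernelLegCauchyΦ … Φ (canonLegDist F) κ′ 𝔠.κ a C`, (A) = (R2′) `ChartAnalyticΦ … (rescaleΦw (canonLegDist F) κ′ Φ) 𝔠.κ ρ C_A`,
  (N) `NewLevelIsBirthRows`, (M1) `OldTermsAreJetsOwnRows` — (A)(N)(M1) VERBATIM as in `K1aLegRowsDisplayChiAtV4` —, (S) = (44) `CfgDistΦ … B (canonLegDist F) 𝔠.b₀ p₁ C_s` and
  (BC) `CfgDistCauchyΦ … B (canonLegDist F) 𝔠.b₀ p₁ a C_B`.  No `Ψ`, no `BR`; `OfV4ChiAt →` before `∃ p` as in `K1aLegRowsRChiV4`.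
* §2 «NOTHING LOST»: **`k1aLegRowsDisplayTwoRunChiAtV4_of_displayChiAtV4`** (`0 ≤ a`; constants `C ↦ 2C`, `C_B ↦ 2C_B` — exactly the consumer's three conversion lines) and
  **`k1aLegRowsDisplayTwoRunChiAtV4_of_displayChiAtLowV4`** (`p₀ + r₀ ≤ p₁`, through ✓`k1aLegRowsDisplayChiAtV4_of_low`).
* §3 **`globalSupRateTSlack_of_k1aLegRowsDisplayTwoRunChiAtV4`**: for `0 < a < 1`, `p₀ + r₀ ≤ p₁`, the two-run display gives King's slack row at `(𝔠.b₀, p₁)` — conclusion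
  byte-identical to ✓`globalSupRateTSlack_of_k1aLegRowsDisplayChiAtV4`, proof = its proof with the three conversion lines deleted.
* §4 **`InteriorExcision.regPrIntL_of_T8_recChiV4_k1aLegRowsDisplayTwoRunChiAtV4_allL`**, **`…_of_halving_exist_recChiV4_k1aLegRowsDisplayTwoRunChiAtV4_allL`**: the DECIDING crux from
  T8 (resp. 19200's two v10 leaves H, EX verbatim), 2′χ(v4) and — for every odd `L > 1`, every record and [7]-constants — a rate, a profile `p₁ ≥ p₀ + r₀` and the two-run display;
  hypotheses byte-identical to ✓`regPrIntL_of_T8_recChiV4_k1aLegRowsDisplayChiAtV4_allL` / ✓`regPrIntL_of_halving_exist_recChiV4_k1aLegRowsDisplayChiAtV4_allL` but for the display's name.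

HONEST FRAMING.  Bookkeeping over hypothesis schemas: the six rows remain DISPLAYS of the (α)-record desk (NODE-O / B0); (K) and (BC) are the two cross-cut-off rows that are
UNPRINTED for non-abelian `d = 3` (INPUT-LIST §5 item 3, E2 = NO) and are NOT asserted here; nothing of [Balaban1985UV3] / [King1986] is asserted; no stub, crux or registry
object is touched (`--supports stmt-QuantumFields-20520`); YM₃ on the 3-torus is ladder rung R3, not the Clay problem / 𝕋⁴ / a mass gap.

References: C. King, CMP 102 (1986) 649–677 [King1986] (Thm 3.4 (3.9) p.656, Prop. 3.6 (3.56) p.662, Prop. 3.9 (3.71)–(3.74) p.665); T. Bałaban, CMP 102 (1985) 255–275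
[Balaban1985UV3] ((7) p.257, (24)–(25) p.262, (27)–(28) p.263, (43)–(47) pp.266–267, (57) p.270, (61)–(63) pp.271–272, Thm 2 p.272); CMP 102 (1985) 277–309
[Balaban1985Variational] (Thm 1 (8) p.279, Prop. 7 p.299, Prop. 8 p.304); CMP 109 (1987) 249–301 [Balaban1987RG1] ((0.1) p.251, (0.4) p.253).
-/

set_option autoImplicit false

noncomputable section

open scoped BigOperators
open Finset
open Literature.MathematicalPhysics.QuantumFieldTheory.Balaban1983to89
open Literature.MathematicalPhysics.QuantumFieldTheory.Balaban1983to89.T3ContinuumYM3Torus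
open Literature.MathematicalPhysics.QuantumFieldTheory.Balaban1983to89.T3UnitScaleTilt
open Literature.MathematicalPhysics.QuantumFieldTheory.Balaban1983to89.T3LevelShift
open Literature.MathematicalPhysics.QuantumFieldTheory.Balaban1983to89.T3AlphaInputsAC
open Literature.MathematicalPhysics.QuantumFieldTheory.Balaban1983to89.T3AlphaPolymerSocket
open Literature.MathematicalPhysics.QuantumFieldTheory.Balaban1983to89.T3AlphaInputsACTwoRun
open Literature.MathematicalPhysics.QuantumFieldTheory.Balaban1983to89.T3AlphaInputsACTwoRunLevel
open Literature.MathematicalPhysics.QuantumFieldTheory.Balaban1983to89.B12TreeDecay (kappa₀ K₀ K₀_pos kappa₀_nonneg)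
open Literature.MathematicalPhysics.QuantumFieldTheory.Balaban1985CMP102
open Literature.MathematicalPhysics.QuantumFieldTheory.Balaban1985CMP102.Setting
open Summit.QuantumFields.Balaban3D.Carriers
open Summit.QuantumFields.Balaban3D.Proofs.Primitives
open Summit.QuantumFields.Balaban3D.Proofs.GroupModelLieC (lieC)
open Summit.QuantumFields.Balaban3D.Proofs.NewbornJet (tlConst tlConst_nonneg)
open Summit.QuantumFields.YangMills.Theorems
open Summit.QuantumFields.YangMills.Theorems.GlobalSlack (GlobalSupRateTSlack)
open Summit.QuantumFields.YangMills.Theorems.GlobalSlackKernelMatching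
open Summit.QuantumFields.YangMills.Theorems.GlobalSlackCanonicalPolymers

namespace Summit.QuantumFields.YangMills.Theorems.GlobalSlackKernelLeg

/-! ## §1 The six-row display at a free profile, in two-run currency -/

/-- **3⁗χ AS ONE DISPLAY OBLIGATION AT THE LOG-PROFILE `p₁`, IN TWO-RUN CURRENCY** (hypothesis schema, never asserted): a weight rate `κ′ > 0`, a radius `ρ > 0`, nonnegative
constants, a threshold `γB`; for every family of block size `L`, every coupling `γ ≤ γB` in the record's window and every inhabited χ-package a coherent `p` and ONE `(Φ, e, B)` with
(K) K1a `FlatKernelLegCauchyΦ` (the charts' weighted flat kernels of the two runs are close at the rate `(L^{−(1+b)})^a`, [King1986] Prop. 3.6 read across one refinement step),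
(A) `ChartAnalyticΦ … (rescaleΦw (canonLegDist F) κ′ Φ) 𝔠.κ ρ C_A`, (N) `NewLevelIsBirthRows`, (M1) `OldTermsAreJetsOwnRows`, (S) (44) `CfgDistΦ … 𝔠.b₀ p₁ C_s` and (BC)
`CfgDistCauchyΦ … 𝔠.b₀ p₁ a C_B` (the loop variables of the two runs are close, [King1986] Prop. 3.9 read across one step) — all at the χ-datum's canonical polymerisation and the
canonical leg distance.  The per-run displays `K1aLegRowsDisplayChiAtV4` / `…LowV4` imply it (§2).  Meant at `p₁ ≥ 𝔠.p₀ + 𝔠.r₀` (§3).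
[cite: King1986, Thm 3.4 (3.9) p.656, Prop. 3.6 (3.56) p.662, Prop. 3.9 (3.71)-(3.74) p.665; Balaban1985UV3, (25) p.262, (43)-(45) pp.266-267, (57) p.270, (61)-(63) pp.271-272] -/
def K1aLegRowsDisplayTwoRunChiAtV4 (L : ℕ) (𝔠 : AlphaConsts L (suGroupModel 2).N) (a₀ a₁ a p₁ : ℝ) : Prop :=
  ∃ (κ' ρ C C_A C_s C_B γB : ℝ), 0 < κ' ∧ 0 < ρ ∧ 0 ≤ C ∧ 0 ≤ C_A ∧ 0 ≤ C_s ∧ 0 ≤ C_B ∧ 0 < γB ∧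
    ∀ (F : T3Family) (γ : ℝ) (hF : F.L = L) (hγ : 0 < γ), γ ≤ γB → ∀ (hγ1 : γ ≤ (min (hF ▸ 𝔠).gamma0 1) ^ 2),
      AlphaInputsT3AC.OfV4ChiAt F (hF ▸ 𝔠) a₀ a₁ →
        ∃ (p : ∀ K, AlphaInputsT3AC.PkgAtV4Chi F (hF ▸ 𝔠) γ hγ hγ1 K), (∀ K, (p K).a₀ = a₀ ∧ (p K).a₁ = a₁) ∧
          ∃ (Φ : ChartFam ↥(lieC (suGroupModel 2)) F) (e : VacFam F) (B : CfgFam ↥(lieC (suGroupModel 2)) F),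
            FlatKernelLegCauchyΦ (AlphaInputsT3AC.dataOfV4chi p (canonPolymerRows fun K => (p K).toRows)) Φ (canonLegDist F) κ' (hF ▸ 𝔠).κ a C ∧
            ChartAnalyticΦ (AlphaInputsT3AC.dataOfV4chi p (canonPolymerRows fun K => (p K).toRows)) (rescaleΦw (canonLegDist F) κ' Φ) (hF ▸ 𝔠).κ ρ C_A ∧
            NewLevelIsBirthRows (fun K => (p K).toRows) Φ e B ∧
            OldTermsAreJetsOwnRows (fun K => (p K).toRows) Φ e B ∧
            CfgDistΦ (AlphaInputsT3AC.dataOfV4chi p (canonPolymerRows fun K => (p K).toRows)) B (canonLegDist F) (hF ▸ 𝔠).b₀ p₁ C_s ∧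
            CfgDistCauchyΦ (AlphaInputsT3AC.dataOfV4chi p (canonPolymerRows fun K => (p K).toRows)) B (canonLegDist F) (hF ▸ 𝔠).b₀ p₁ a C_B

/-! ## §2 «Nothing lost»: the per-run displays of record imply the two-run display -/

/-- **THE PER-RUN SIX-ROW DISPLAY IMPLIES THE TWO-RUN DISPLAY** («nothing lost»; `0 ≤ a`): exactly the three conversion lines of ✓`globalSupRateTSlack_of_k1aLegRowsDisplayChiAtV4` —
(R1) + the height-free `Ψ` ⟹ (K) with constant `2C` (`flatKernelLegCauchyΦ_of_ref ∘ kernelRefΦ_canonRows_of_own`), (R4) ⟹ (S) (`cfgDistΦ_of_own`), (R5) + the coherent `BR` ⟹ (BC)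
with constant `2C_B` (`cfgDistCauchyΦ_of_ref ∘ cfgRefΦ_of_own`); (A)(N)(M1) unchanged. [cite: King1986, Prop. 3.6 (3.56) p.662, Prop. 3.9 (3.71)-(3.74) p.665; Balaban1985UV3, (24)-(25) p.262, (44) p.267] -/
theorem k1aLegRowsDisplayTwoRunChiAtV4_of_displayChiAtV4 {L : ℕ} {𝔠 : AlphaConsts L (suGroupModel 2).N} {a₀ a₁ a p₁ : ℝ} (ha : 0 ≤ a)
    (h : K1aLegRowsDisplayChiAtV4 L 𝔠 a₀ a₁ a p₁) : K1aLegRowsDisplayTwoRunChiAtV4 L 𝔠 a₀ a₁ a p₁ := by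
  obtain ⟨κ', ρ, C, C_A, C_s, C_B, γB, hκ', hρ, hC, hCA, hCs, hCB, hγB, hall⟩ := h
  refine ⟨κ', ρ, 2 * C, C_A, C_s, 2 * C_B, γB, hκ', hρ, by positivity, hCA, hCs, by positivity, hγB, fun F γ hF hγ hγle hγ1 hOf => ?_⟩
  subst hF
  obtain ⟨Ψ, BR, hΨ, hBR, himp⟩ := hall F γ rfl hγ hγle hγ1
  obtain ⟨p, hp', Φ, e, B, hK, hA, hN, hM1, hS, hBC⟩ := himp hOf
  set q : ∀ K, AlphaInputsT3AC.PkgCoreRows F 𝔠 γ hγ hγ1 K := fun K => (p K).toRows with hq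
  have hL : 1 ≤ F.L := F.hL.2.le
  have hγ1' : γ ≤ 1 := hγ1.trans (sq_min_one_le _ 𝔠.gamma0_pos)
  obtain ⟨hκ0, -⟩ := kappa_record_admissible 𝔠
  have hn := canonLegDist_nonneg F
  have hm := canonLegDist_matched F
  exact ⟨p, hp', Φ, e, B, flatKernelLegCauchyΦ_of_ref hΨ (kernelRefΦ_canonRows_of_own p hκ0.le hC ha hK), hA, hN, hM1,
    cfgDistΦ_of_own (locMatched_canonRows q) hm hS,
    cfgDistCauchyΦ_of_ref hBR (cfgRefΦ_of_own (locMatched_canonRows q) hm hn hL hγ hγ1' 𝔠.b₀_pos hCB ha hBC)⟩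

/-- **THE PER-RUN DISPLAY WITH (R4) BELOW THE NEW LEVEL ONLY IMPLIES THE TWO-RUN DISPLAY** at the door's profiles `p₁ ≥ p₀ + r₀` (`0 ≤ a`):
`k1aLegRowsDisplayTwoRunChiAtV4_of_displayChiAtV4 ∘ k1aLegRowsDisplayChiAtV4_of_low`. [cite: Balaban1985UV3, (27)-(28) p.263, (44) p.267; King1986, Prop. 3.6 (3.56) p.662] -/
theorem k1aLegRowsDisplayTwoRunChiAtV4_of_displayChiAtLowV4 {L : ℕ} {𝔠 : AlphaConsts L (suGroupModel 2).N} {a₀ a₁ a p₁ : ℝ} (ha : 0 ≤ a) (hp : 𝔠.p₀ + 𝔠.r₀ ≤ p₁)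
    (h : K1aLegRowsDisplayChiAtLowV4 L 𝔠 a₀ a₁ a p₁) : K1aLegRowsDisplayTwoRunChiAtV4 L 𝔠 a₀ a₁ a p₁ :=
  k1aLegRowsDisplayTwoRunChiAtV4_of_displayChiAtV4 ha (k1aLegRowsDisplayChiAtV4_of_low hp h)

/-! ## §3 King's slack row at the profile `p₁` from the two-run display -/

/-- **THE TWO-RUN SIX-ROW DISPLAY AT `p₁ ≥ p₀ + r₀` GIVES KING'S SLACK ROW AT `p₁`** (window AND both summands at `(𝔠.b₀, p₁)`): for `0 < a < 1`, `𝔠.p₀ + 𝔠.r₀ ≤ p₁` and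
`K1aLegRowsDisplayTwoRunChiAtV4 L 𝔠 a₀ a₁ a p₁` there is a threshold `γB′ > 0` such that every family of block size `L`, every coupling `γ ≤ γB′` in the record's window and every
inhabited χ-package admit a coherent `p`, the canonical polymerisation `π := canonPolymerRows (toRows ∘ p)` and `σ ≥ 7`, `C ≥ 0` with `GlobalSupRateTSlack (dataOfV4chi p π) 𝔠.b₀ p₁ a σ C` —
✓`globalSupRateTSlack_of_k1aLegRowsDisplayChiAtV4`'s chain entered AFTER its own → two-run conversion: (R3) at `p₁` from (N) ∧ (M1) (`remainderSmallOwnΦ_chiV4_of_jets_profile`,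
`remainderSmallΦ_of_own`), (A) ⟹ `KernelLegΦ` (`kernelLegΦ_of_chartAnalyticLeg`), leg → chart currency (`taylorSplitΦ_rescaleW ∘ taylorSplitΦ_residualRows`, `flatKernelCauchyΦ_rescaleW`,
`kernelSizeΦ_rescaleW`, `cfgSizeΦ_rescaleW`, `cfgCauchyΦ_rescaleW`), producer rows of the canonical polymerisation, composition `globalTwoRunSlackTail_of_chartsC`; threshold
`γB ⊓ gammaW L 𝔠 C_s′ C_B′ ⊓ gammaθ 𝔠.b₀ p₁ (1/max 1 (C_s′+C_B′)) ⊓ e^{2(1−p₁)}` with `C_s′ = C_s(1+κ′⁻¹)`, `C_B′ = C_B(1+κ′⁻¹)`.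
[cite: King1986, Thm 3.4 (3.9) p.656, Prop. 3.6 (3.56) p.662, Prop. 3.9 (3.71)-(3.74) p.665; Balaban1985UV3, (7) p.257, (24)-(25) p.262, (43)-(47) pp.266-267, (57) p.270, (61)-(63) pp.271-272] -/
theorem globalSupRateTSlack_of_k1aLegRowsDisplayTwoRunChiAtV4 {L : ℕ} {𝔠 : AlphaConsts L (suGroupModel 2).N} {a₀ a₁ a p₁ : ℝ}
    (ha : 0 < a) (ha1 : a < 1) (hp : 𝔠.p₀ + 𝔠.r₀ ≤ p₁) (h : K1aLegRowsDisplayTwoRunChiAtV4 L 𝔠 a₀ a₁ a p₁) :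
    ∃ γB : ℝ, 0 < γB ∧ ∀ (F : T3Family) (γ : ℝ) (hF : F.L = L) (hγ : 0 < γ), γ ≤ γB →
      ∀ (hγ1 : γ ≤ (min (hF ▸ 𝔠).gamma0 1) ^ 2),
        AlphaInputsT3AC.OfV4ChiAt F (hF ▸ 𝔠) a₀ a₁ →
          ∃ (p : ∀ K, AlphaInputsT3AC.PkgAtV4Chi F (hF ▸ 𝔠) γ hγ hγ1 K), (∀ K, (p K).a₀ = a₀ ∧ (p K).a₁ = a₁) ∧
            ∃ (π : AlphaInputsT3AC.PolymerT3 F) (σ : ℕ) (C : ℝ), 7 ≤ σ ∧ 0 ≤ C ∧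
              GlobalSupRateTSlack (AlphaInputsT3AC.dataOfV4chi p π) (hF ▸ 𝔠).b₀ p₁ a σ C := by
  obtain ⟨κ', ρ, C, C_A, C_s, C_B, γB, hκ', hρ, hC, hCA, hCs, hCB, hγB, hall⟩ := h
  -- the derived constants of the chart currency
  have hk1 : 0 ≤ 1 + κ'⁻¹ := by positivity
  set C_s' : ℝ := C_s * (1 + κ'⁻¹) with hCs'
  set C_B' : ℝ := C_B * (1 + κ'⁻¹) with hCB'
  have hCs'0 : 0 ≤ C_s' := mul_nonneg hCs hk1
  have hCB'0 : 0 ≤ C_B' := mul_nonneg hCB hk1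
  have hp₀p₁ : 𝔠.p₀ ≤ p₁ := le_trans (le_add_of_nonneg_right (le_trans zero_le_one 𝔠.one_le_r₀)) hp
  have hp₁ : 0 < p₁ := lt_of_lt_of_le 𝔠.p₀_pos hp₀p₁
  have hm0 : 0 < max 1 (C_s' + C_B') := lt_of_lt_of_le one_pos (le_max_left _ _)
  refine ⟨min γB (min (gammaW L 𝔠 C_s' C_B') (min (gammaθ 𝔠.b₀ p₁ (1 / max 1 (C_s' + C_B'))) (Real.exp (2 * (1 - p₁))))),
    lt_min hγB (lt_min (gammaW_pos L 𝔠 C_s' C_B') (lt_min (gammaθ_pos 𝔠.b₀_pos hp₁ (by positivity)) (Real.exp_pos _))),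
    fun F γ hF hγ hγle hγ1 hOf => ?_⟩
  subst hF
  have hL : 1 ≤ F.L := F.hL.2.le
  have hγ1' : γ ≤ 1 := hγ1.trans (sq_min_one_le _ 𝔠.gamma0_pos)
  have hγB' : γ ≤ γB := hγle.trans (min_le_left _ _)
  have hW : γ ≤ gammaW F.L 𝔠 C_s' C_B' := hγle.trans ((min_le_right _ _).trans (min_le_left _ _))
  have h0 : γ ≤ gammaθ 𝔠.b₀ p₁ (1 / max 1 (C_s' + C_B')) := hγle.trans ((min_le_right _ _).trans ((min_le_right _ _).trans (min_le_left _ _)))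
  have hγe : Real.sqrt γ ≤ Real.exp (1 - p₁) :=
    sqrt_le_exp_of_le (hγle.trans ((min_le_right _ _).trans ((min_le_right _ _).trans (min_le_right _ _))))
  have h1 : γ ≤ gammaθ 𝔠.b₀ (𝔠.p₀ + 𝔠.r₀) (𝔠.ρ / (4 * max 1 𝔠.cB)) := hW.trans ((min_le_right _ _).trans (min_le_left _ _))
  have h2 : γ ≤ gammaθ 𝔠.b₀ 𝔠.p₀ (1 / (2 * (8 * ((F.L : ℝ) + 1) ^ 2 * 𝔠.B₃ * 𝔠.Zfull))) := hW.trans ((min_le_right _ _).trans (min_le_right _ _))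
  -- the display at this family / coupling / package (already in two-run currency)
  obtain ⟨p, hp', Φ, e, B, hK2, hA, hN, hM1, hS2, hBC2⟩ := hall F γ rfl hγ hγB' hγ1 hOf
  set q : ∀ K, AlphaInputsT3AC.PkgCoreRows F 𝔠 γ hγ hγ1 K := fun K => (p K).toRows with hq
  obtain ⟨hκ0, hκ₀⟩ := kappa_record_admissible 𝔠
  have hn := canonLegDist_nonneg F
  have hm := canonLegDist_matched F
  -- (R3) at `p₁` is a theorem of (N) ∧ (M1)
  have hCR0 : 0 ≤ (𝔠.Cfar * 𝔠.C25 * tlConst (7 * 𝔠.r₀) 1 + 𝔠.Cfar * 𝔠.C63) * ((Real.sqrt F.L)⁻¹ * (1 + Real.log (Real.sqrt F.L)) ^ p₁) ^ 7 := by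
    have := 𝔠.Cfar_nonneg; have := 𝔠.C25_nonneg; have := 𝔠.C63_nonneg
    have := tlConst_nonneg (q := 7 * 𝔠.r₀) (c := 1) (by linarith [𝔠.one_le_r₀]) one_pos
    have := heightUpFactor_nonneg (F := F) p₁
    positivity
  have hR := remainderSmallOwnΦ_chiV4_of_jets_profile p hp hN hM1
  -- the remaining per-run rows in two-run currency
  have hE2 := kernelLegΦ_of_chartAnalyticLeg hA
  have hR2 := remainderSmallΦ_of_own (locMatched_canonRows q) (treeLenRefinedOn_canonRows q) hκ0.le hCR0 hL hγ hγ1' 𝔠.b₀_pos hR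
  -- leg → chart currency
  have hT3 := taylorSplitΦ_rescaleW (canonLegDist F) κ' (taylorSplitΦ_residualRows q Φ e B)
  have hK3 := flatKernelCauchyΦ_rescaleW hm hK2
  have hE3 := kernelSizeΦ_rescaleW hE2
  have hS3 := cfgSizeΦ_rescaleW hL hγ hγ1' 𝔠.b₀_pos hn hm hκ' hCs hS2
  have hBC3 := cfgCauchyΦ_rescaleW hL hγ hγ1' 𝔠.b₀_pos hn hm hκ' hCB hBC2
  -- the coupling windows
  have hwin : ∀ n, (C_s' + C_B') * θBal F.L γ 𝔠.b₀ p₁ n ≤ 1 := fun n => window_sum_le_one hL 𝔠.b₀_pos hp₁ hγ hγ1' h0 n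
  have hw1 := fun K k hk => window_jet (hγ := hγ) (hγ1 := hγ1) h1 K k hk
  have hw2 := fun K k hk => window_oldSlice (hγ := hγ) (hγ1 := hγ1) h2 K k hk
  have hCT : 0 ≤ max (newConst 𝔠) (oldConst 𝔠 * (F.L : ℝ) ^ 4 * Real.exp (𝔠.κ * (F.L : ℝ) ^ 3)) := le_max_of_le_left (newConst_nonneg 𝔠)
  have hCE0 : 0 ≤ C_A * (max 1 (12 / ρ)) ^ 6 := by positivity
  obtain ⟨σ, C₀, hσ, hC₀, hG⟩ := globalTwoRunSlackTail_of_chartsC (D := AlphaInputsT3AC.dataOfCoreRows q (canonPolymerRows q))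
    hγ hγ1' hγe 𝔠.b₀_pos hp₁.le ha ha1 hC hCE0 hCR0 hCs'0 hCB'0 hCT
    hwin (pintDecompTrivT_canonRows q) (locCover_canonRows q hκ0.le hκ₀) (locBlockVolumeC_canonRows q) (locMatched_canonRows q)
    (termSizeTrivT_canonRows_profile q hκ0 le_rfl hw1 hw2 hp₀p₁) hT3 hK3 hE3 hR2 hS3 hBC3
  exact ⟨p, hp', canonPolymerRows q, σ, C₀, hσ, hC₀, hG⟩

end Summit.QuantumFields.YangMills.Theorems.GlobalSlackKernelLeg

namespace Summit.QuantumFields.YangMills.Theorems.InteriorExcision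

open Literature.MathematicalPhysics.QuantumFieldTheory.Balaban1983to89.T3UnitLawDensityEML (ℰp)
open Literature.MathematicalPhysics.QuantumFieldTheory.Balaban1983to89.T3InteriorExcision
open Literature.MathematicalPhysics.QuantumFieldTheory.Balaban1983to89.T3PrintedRegularMinimiser
open Literature.MathematicalPhysics.QuantumFieldTheory.Balaban1983to89.T3PrintedMinimiserExistence
open Literature.MathematicalPhysics.QuantumFieldTheory.Balaban1983to89.T3SmallLiftHistory
open Literature.MathematicalPhysics.QuantumFieldTheory.Balaban1983to89.T3LowerAlongMinimisersSplit (MinimisersIn8At)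
open Literature.MathematicalPhysics.QuantumFieldTheory.Balaban1983to89.T3ConstrainedMinimiser (fibre)
open Literature.MathematicalPhysics.QuantumFieldTheory.Balaban1983to89.T3Thm1Carrier (famX Idx)
open Summit.QuantumFields.YangMills.Theorems.GlobalSlackKernelLeg (K1aLegRowsDisplayTwoRunChiAtV4 globalSupRateTSlack_of_k1aLegRowsDisplayTwoRunChiAtV4)

/-! ## §4 The deciding crux through the higher-profile door, fed by the two-run display -/

/-- **THE DECIDING CRUX FROM T8, THE χ-RECORD AND THE TWO-RUN SIX-ROW DISPLAY AT A SUPPLIER-CHOSEN PROFILE `p₁ ≥ p₀ + r₀`, EVERY ODD BLOCK SIZE**: T8's text, 2′χ(v4), and — for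
every odd `L > 1`, every record and [7]-constants — a rate `a ∈ (0,1)`, a profile `p₁` with `𝔠.p₀ + 𝔠.r₀ ≤ p₁` and `K1aLegRowsDisplayTwoRunChiAtV4 L 𝔠 a₀ a₁ a p₁`, give
`FluctuationComparisonRegPrIntL` — ✓`regPrIntL_of_T8_recChiV4_k1aLegRowsDisplayChiAtV4_allL`'s proof with §3 in place of its §2: STUB 1 by `ApproxLift.AnsatzT.stub_oneStepSmallLift`, the
slack row at `(𝔠.b₀, p₁)` restricted to print's `χ` by `GlobalSlackOn.on_of_global`, then ★r1 g5's door `regPrIntL_of_recChiV4_slackOnChi_higherProfile_allL`.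
[cite: King1986, Thm 3.4 (3.9) p.656, (3.42) p.660; Balaban1985UV3, (41) p.266, (43)-(47) pp.266-267, (57) p.270, (61)-(63) pp.271-272, Thm 2 p.272; Balaban1985Variational, Thm 1 (8) p.279; Balaban1987RG1, (0.4) p.253] -/
theorem regPrIntL_of_T8_recChiV4_k1aLegRowsDisplayTwoRunChiAtV4_allL
    (hT8 : ∀ L : ℕ, Odd L → 1 < L → ∃ a₀ a₁ B₃ : ℝ, 0 < a₀ ∧ 0 < a₁ ∧ 0 < B₃ ∧
      Thm1GlobalMinAt L a₀ a₁ B₃ ∧ MinimisersIn8At L a₀ a₁ B₃)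
    (h2 : ∀ L : ℕ, Odd L → 1 < L → Summit.QuantumFields.YangMills.Theorems.AlphaInputsT3ACv4RecChi L)
    (hDisp : ∀ (L : ℕ), Odd L → 1 < L → ∀ (𝔠 : AlphaConsts L (suGroupModel 2).N) (a₀ a₁ : ℝ), 0 < a₀ → 0 < a₁ → 𝔠.B₃ * a₁ ≤ a₀ →
      ∃ a : ℝ, 0 < a ∧ a < 1 ∧ ∃ p₁ : ℝ, 𝔠.p₀ + 𝔠.r₀ ≤ p₁ ∧ K1aLegRowsDisplayTwoRunChiAtV4 L 𝔠 a₀ a₁ a p₁) :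
    FluctuationComparisonRegPrIntL := by
  refine regPrIntL_of_recChiV4_slackOnChi_higherProfile_allL Summit.QuantumFields.YangMills.Theorems.ApproxLift.AnsatzT.stub_oneStepSmallLift hT8 h2
    fun L hLo hL μ _ _ 𝔠 a₀ a₁ ha0 ha1 hw => ?_
  obtain ⟨a, ha, ha1, p₁, hp₁, hD⟩ := hDisp L hLo hL 𝔠 a₀ a₁ ha0 ha1 hw
  obtain ⟨γB, hγB, hall⟩ := globalSupRateTSlack_of_k1aLegRowsDisplayTwoRunChiAtV4 ha ha1 hp₁ hD
  have hp₀p₁ : 𝔠.p₀ ≤ p₁ := le_trans (le_add_of_nonneg_right (le_trans zero_le_one 𝔠.one_le_r₀)) hp₁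
  refine ⟨a, ha, ha1, p₁, hp₀p₁, γB, hγB, fun F γ hF hγ hγle hγ1 hOf => ?_⟩
  obtain ⟨p, hp, π, σ, C, hσ, hC, hG⟩ := hall F γ hF hγ hγle hγ1 hOf
  exact ⟨p, hp, π, σ, C, hσ, hC, fun ε₀ _ _ => GlobalSlackOn.on_of_global _ _ hG⟩

/-- **THE DECIDING CRUX FROM 19200's TWO v10 LEAVES, THE χ-RECORD AND THE TWO-RUN SIX-ROW DISPLAY AT `p₁ ≥ p₀ + r₀`** (DEPMAP «20520 ⇐ {H, EX, 2′χ, one K1a predicate}», the K1a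
predicate now in two-run currency): the texts of `stub_halvingStep` (H) and `stub_existenceMinimalOrbit` (EX) VERBATIM, 2′χ(v4), and the display `K1aLegRowsDisplayTwoRunChiAtV4` at a
supplier-chosen profile give `FluctuationComparisonRegPrIntL` — T8 by ★w4-20520 g0's `AttainmentOfExistence.thm1In8GlobalMin_of_halvingStep_of_existence`, then
`regPrIntL_of_T8_recChiV4_k1aLegRowsDisplayTwoRunChiAtV4_allL`.
[cite: Balaban1985Variational, Thm 1 (8) p.279, Prop. 7 p.299, Prop. 8 p.304; Balaban1985UV3, (41) p.266, (43)-(47) pp.266-267, (57) p.270, (61)-(63) pp.271-272, Thm 2 p.272; King1986, Thm 3.4 (3.9) p.656, Prop. 3.6 (3.56) p.662] -/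
theorem regPrIntL_of_halving_exist_recChiV4_k1aLegRowsDisplayTwoRunChiAtV4_allL
    (hV2 : ∀ (L : ℕ), 1 < L → ∃ B₃ : ℝ, 4 < B₃ ∧ ∃ a₅ : ℝ, 0 < a₅ ∧
      ∀ (i : Idx L) (ε₀ ε₁ : ℝ), 0 < ε₁ → ∀ (V : (famX L i).Bdry) (U : (famX L i).Cfg), (famX L i).Reg7 ε₁ V → (famX L i).InU ε₀ U →
        (famX L i).InB V U → (famX L i).IsCritical V U → ε₀ ≤ a₅ → (famX L i).InU (max (B₃ * ε₁) (ε₀ / 2)) U)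
    (hEX : ∀ (L : ℕ), 1 < L → ∀ (B₃ : ℝ), 4 < B₃ → ∃ a₁' O₁ : ℝ, 0 < a₁' ∧ 1 ≤ O₁ ∧
      ∀ (F : T3Family), F.L = L → ∀ (n K : ℕ) (hnK : n < K) (ε₁ : ℝ), 0 < ε₁ →
        ∀ V : GaugeField (F.P n) 0 (Matrix.specialUnitaryGroup (Fin 2) ℂ), PlaqSmall ε₁ V →
          ∀ U₀ : GaugeField (F.P K) 0 (Matrix.specialUnitaryGroup (Fin 2) ℂ), RegPr F n K ((L : ℝ) ^ 3 * B₃ * ε₁) U₀ → U₀ ∈ fibre F ℰp n K hnK.le V →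
            ε₁ ≤ a₁' → ∃ U ∈ regFibrePr F n K hnK.le (O₁ * (L : ℝ) ^ 3 * B₃ * ε₁) V,
              IsMinOn (fun W : GaugeField (F.P K) 0 (Matrix.specialUnitaryGroup (Fin 2) ℂ) => wilsonAction4 W)
                (regFibrePr F n K hnK.le (O₁ * (L : ℝ) ^ 3 * B₃ * ε₁) V) U)
    (h2 : ∀ L : ℕ, Odd L → 1 < L → Summit.QuantumFields.YangMills.Theorems.AlphaInputsT3ACv4RecChi L)
    (hDisp : ∀ (L : ℕ), Odd L → 1 < L → ∀ (𝔠 : AlphaConsts L (suGroupModel 2).N) (a₀ a₁ : ℝ), 0 < a₀ → 0 < a₁ → 𝔠.B₃ * a₁ ≤ a₀ →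
      ∃ a : ℝ, 0 < a ∧ a < 1 ∧ ∃ p₁ : ℝ, 𝔠.p₀ + 𝔠.r₀ ≤ p₁ ∧ K1aLegRowsDisplayTwoRunChiAtV4 L 𝔠 a₀ a₁ a p₁) :
    FluctuationComparisonRegPrIntL :=
  regPrIntL_of_T8_recChiV4_k1aLegRowsDisplayTwoRunChiAtV4_allL (AttainmentOfExistence.thm1In8GlobalMin_of_halvingStep_of_existence hV2 hEX) h2 hDisp

end Summit.QuantumFields.YangMills.Theorems.InteriorExcision

end
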